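import Summits.MatrixMultiplication.MatrixMultiplication.Theorems.AbelianSTPPCensusTAStatKMemberXWalk

/-!
# Static t*-certificate: assembling one shape check bucket by bucket — the `walk5` form (universes `V < 8100`, data-free)

Cell mm-stpp (rung F-M1).  `AbelianSTPPCensusTAStatKMemberXWalk.lean` (vp-p2 gen 7) assembles the bucket walk `TAStatKM.walk4` of a shape from per-bucket
facts (root-split kernel layout of the T_B range `5995 … 6012`).  The T_A ranges above `6400` walk with `TAStatKM.walk5`
(`AbelianSTPPCensusTAStatKMemberX2.lean`, vp-p2 gen 6: escape `tiOK90` instead of `tiOK`); this file is the same bookkeeping for `walk5` —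
`walk5_nil_eq`, `walk5_cons_eq`, `walk5_cons_of_or`, `walk5_cons_of_coverKX`, `walk5_cons_of_tiOK90` — used by the T_A range `6780 … 6833`
(PRE-REG v1 band B2⁺), whose four exploding cells are kernel-checked in `goIR` pieces.
No soundness content: equalities between Bool computations; `walk5_sound` / `rootKX_sound` apply to the assembled facts exactly as before.
WHAT THIS IS NOT: no statement about STPP families, orders or `ω`.
-/

set_option linter.dupNamespace false
set_option autoImplicit false

namespace Summit.MatrixMultiplication.MatrixMultiplication.Theorems.TAStatKM

open TAStat (Entry cover)

section Walk5

variable (tb : ℕ → ℕ) (m2 : ℕ → List (ℕ × ℕ × ℕ)) (gain : ℕ → ℕ) (row : ℕ → Entry) (xrow : ℕ → List (ℕ × ℕ × ℕ)) (tp : ℕ → ℕ)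

/-- the walk over an exhausted row passes [bookkeeping] -/
theorem walk5_nil_eq (g p V d al tl kmax L H j0 j : ℕ) :
    walk5 tb m2 gain row xrow tp g p V d al tl kmax L H j0 [] j = true := rfl

/-- one step of the walk, unfolded [bookkeeping] -/
theorem walk5_cons_eq (g p V d al tl kmax L H j0 j : ℕ) (e : Entry) (es : List Entry) :
    walk5 tb m2 gain row xrow tp g p V d al tl kmax L H j0 (e :: es) j =
      (tiOK90 V (tb j) || ((cover g p V d (tp j) L H e || coverKX tb m2 gain row xrow g p V d al tl kmax j j0 L H) &&
        walk5 tb m2 gain row xrow tp g p V d al tl kmax L H j0 es (j + 1))) := rfl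

variable {tb m2 gain row xrow tp}

/-- **A bucket from its parts, generic form**: the bucket passes by the one-member cover or by the tree cover (one Bool, e.g. by `decide`), and the
rest of the walk passes. [bookkeeping] -/
theorem walk5_cons_of_or {g p V d al tl kmax L H j0 j : ℕ} {e : Entry} {es : List Entry}
    (hc : (cover g p V d (tp j) L H e || coverKX tb m2 gain row xrow g p V d al tl kmax j j0 L H) = true)
    (hw : walk5 tb m2 gain row xrow tp g p V d al tl kmax L H j0 es (j + 1) = true) :
    walk5 tb m2 gain row xrow tp g p V d al tl kmax L H j0 (e :: es) j = true := by
  rw [walk5_cons_eq, hc, hw]; simp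

/-- **A bucket from its parts, tree form**: the bucket's tree cover (assembled separately) and the rest of the walk give the walk. [bookkeeping] -/
theorem walk5_cons_of_coverKX {g p V d al tl kmax L H j0 j : ℕ} {e : Entry} {es : List Entry}
    (hc : coverKX tb m2 gain row xrow g p V d al tl kmax j j0 L H = true)
    (hw : walk5 tb m2 gain row xrow tp g p V d al tl kmax L H j0 es (j + 1) = true) :
    walk5 tb m2 gain row xrow tp g p V d al tl kmax L H j0 (e :: es) j = true := by
  rw [walk5_cons_eq, hc, hw]; simp

/-- a bucket at which the walk escapes (`tiOK90`) [bookkeeping] -/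
theorem walk5_cons_of_tiOK90 {g p V d al tl kmax L H j0 j : ℕ} {e : Entry} {es : List Entry} (h : tiOK90 V (tb j) = true) :
    walk5 tb m2 gain row xrow tp g p V d al tl kmax L H j0 (e :: es) j = true := by
  rw [walk5_cons_eq, h]; simp

end Walk5

end Summit.MatrixMultiplication.MatrixMultiplication.Theorems.TAStatKM
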